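import Mathlib
import HarnessLib
import Literature.Analysis.Approximation.HermiteFejerInterpolation
import Literature.Analysis.Approximation.HermiteFejerBounds

/-!
# Sums of squares of the fundamental polynomials at the Chebyshev zeros: Rivlin, Ex. 1.5.37–1.5.39

Source: T. J. Rivlin, *The Chebyshev Polynomials*, Wiley 1974 (held scan
`book:rivlinnd-chebyshev-polynomials`, bib key `Rivlin1974`), Sect. 1.5, Exercises 1.5.37–1.5.39,
p. 34 of the scan.

The text (`l_{k,n}(T;x)` the fundamental polynomials of Lagrange interpolation at the zeros
`ξ_1, …, ξ_n` of `T_n`, `I = [-1, 1]`).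
* Ex. 1.5.37: `Σ_k l_{k,n}(T; cos θ)² = 1 - 1/(2n) + sin((2n-1)θ)/(2n sin θ)` for `0 < θ < π` and
  `= 2 - 1/n` for `θ = 0, π`.
* Ex. 1.5.38: `lim_n Σ_k l_{k,n}(T;x)² = 1` for `-1 < x < 1` and `= 2` for `x = ±1`.
* Ex. 1.5.39: for each integer `m ≥ 2` and `x ∈ I`, `(Σ_k |l_{k,n}(T;x)|^m)^{1/m} ≤ √2` (hint: with
  the `v_k(T)` of Ex. 1.4.2, `1 = [Σ v_k l_k²]^r ≥ Σ v_k^r l_k^{2r}`; compare Ex. 1.4.9).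

What is here (nodes `chebyshevZero n k`, `k < n`, of the tree's `SchurInequality` file; `l_k` is
Mathlib's `Lagrange.basis (Finset.range n) (chebyshevZero n) k`; `h_k = v_k l_k²` is the tree's
`hermiteFejerH n k` with `Σ_k h_k = 1`, `HermiteFejerInterpolation.sum_hermiteFejerH_eval`, and
`v_k(x) = (1 - ξ_k x)/(1 - ξ_k²)`, `hermiteFejerH_eval`).
* Ex. 1.5.39: `chebyshevBasis_eval_sq_le_two_mul_hermiteFejerH_eval` (`l_k² ≤ 2 h_k` on `I`, i.e.
  `v_k ≥ 1/2`), `sum_chebyshevBasis_eval_sq_le_two` (the case `m = 2`: `Σ_k l_k(x)² ≤ 2`),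
  `abs_chebyshevBasis_eval_le_sqrt_two` (`|l_k(x)| ≤ √2`), `sum_abs_chebyshevBasis_eval_pow_le`
  (`Σ_k |l_k(x)|^m ≤ (√2)^m`, `m ≥ 2`, from the case `m = 2` and `|l_k| ≤ √2` — a shorter route
  than the hint) and the verbatim `rpow_inv_sum_abs_chebyshevBasis_eval_pow_le`.
* Ex. 1.5.37 at `θ = 0, π` (the endpoint values of Ex. 1.5.38, showing that the bound `2` of the
  case `m = 2` is asymptotically sharp): `l_k(1)² = (1 + ξ_k)/((1 - ξ_k) n²)`,
  `l_k(-1)² = (1 - ξ_k)/((1 + ξ_k) n²)` (`chebyshevBasis_eval_one_sq`,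
  `chebyshevBasis_eval_neg_one_sq` and their division-free forms) and, by the tree's
  `Σ_k 1/(1 ∓ ξ_k) = n²` (`HermiteFejerBounds.sum_inv_one_sub_chebyshevZero` /
  `sum_inv_one_add_chebyshevZero`), `Σ_k l_k(±1)² = 2 - 1/n` (`sum_chebyshevBasis_eval_one_sq`,
  `sum_chebyshevBasis_eval_neg_one_sq`).

NOT typed: the interior formula (1.149)/Ex. 1.5.36–1.5.37 for `0 < θ < π` and the limit Ex. 1.5.38.

Honest framing: shared numerical engines serving client cells; rigour lives in the verifiers; every
published number belongs to a client cell's ledger, not to the engines group.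
-/

open Polynomial Finset Real
open Literature.Analysis.Approximation.HermiteFejerInterpolation
open Literature.Analysis.Approximation.HermiteFejerBounds

namespace Literature.Analysis.Approximation.ChebyshevFundamentalSquares

variable {n k : ℕ}

/-- `1 - ξ² ≤ 2(1 - ξx)` for `x, ξ ∈ [-1, 1]` (i.e. `v_k(x) ≥ 1/2`). [folklore] -/
private theorem one_sub_sq_le_two_mul_one_sub_mul {x ξ : ℝ} (hx : x ∈ Set.Icc (-1 : ℝ) 1)
    (hξ : ξ ∈ Set.Icc (-1 : ℝ) 1) : 1 - ξ ^ 2 ≤ 2 * (1 - ξ * x) := by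
  have h1 : ξ * x ≤ |ξ| := by
    calc ξ * x ≤ |ξ * x| := le_abs_self _
      _ = |ξ| * |x| := abs_mul ξ x
      _ ≤ |ξ| * 1 := by gcongr; exact abs_le.mpr hx
      _ = |ξ| := mul_one _
  have h2 : |ξ| ≤ 1 := abs_le.mpr hξ
  have h3 : 1 - ξ ^ 2 = (1 - |ξ|) * (1 + |ξ|) := by rw [← sq_abs]; ring
  nlinarith [abs_nonneg ξ]

/-- Ex. 1.5.39, the key estimate: `l_{k,n}(T;x)² ≤ 2 h_{k,n}(T;x)` on `I` (since
`v_k(x) = (1 - ξ_k x)/(1 - ξ_k²) ≥ 1/(1 + |ξ_k|) ≥ 1/2`).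
[cite: Rivlin1974, Sect. 1.5 Ex. 1.5.39 (hint)] -/
theorem chebyshevBasis_eval_sq_le_two_mul_hermiteFejerH_eval (hk : k < n) {x : ℝ}
    (hx : x ∈ Set.Icc (-1 : ℝ) 1) :
    ((Lagrange.basis (Finset.range n) (chebyshevZero n) k).eval x) ^ 2
      ≤ 2 * (hermiteFejerH n k).eval x := by
  rw [hermiteFejerH_eval hk]
  have hpos := one_sub_chebyshevZero_sq_pos hk
  have hle := one_sub_sq_le_two_mul_one_sub_mul hx (chebyshevZero_mem_Icc n k)
  set L := ((Lagrange.basis (Finset.range n) (chebyshevZero n) k).eval x) ^ 2 with hL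
  have hl : 0 ≤ L := sq_nonneg _
  rw [← mul_assoc, mul_div_assoc', div_mul_eq_mul_div, le_div_iff₀ hpos]
  calc L * (1 - chebyshevZero n k ^ 2) ≤ L * (2 * (1 - chebyshevZero n k * x)) :=
        mul_le_mul_of_nonneg_left hle hl
    _ = 2 * (1 - chebyshevZero n k * x) * L := by ring

/-- Ex. 1.5.39, the case `m = 2`: `Σ_k l_{k,n}(T;x)² ≤ 2` for `x ∈ I` (by Ex. 1.5.38 the
constant `2` is the limit at `x = ±1`). [cite: Rivlin1974, Sect. 1.5 Ex. 1.5.39] -/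
theorem sum_chebyshevBasis_eval_sq_le_two (hn : 0 < n) {x : ℝ} (hx : x ∈ Set.Icc (-1 : ℝ) 1) :
    ∑ k ∈ range n, ((Lagrange.basis (Finset.range n) (chebyshevZero n) k).eval x) ^ 2 ≤ 2 := by
  calc ∑ k ∈ range n, ((Lagrange.basis (Finset.range n) (chebyshevZero n) k).eval x) ^ 2
      ≤ ∑ k ∈ range n, 2 * (hermiteFejerH n k).eval x :=
        sum_le_sum fun k hk =>
          chebyshevBasis_eval_sq_le_two_mul_hermiteFejerH_eval (mem_range.mp hk) hx
    _ = 2 := by rw [← mul_sum, sum_hermiteFejerH_eval hn, mul_one]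

/-- `|l_{k,n}(T;x)| ≤ √2` for `x ∈ I` (each term of Ex. 1.5.39, `m = 2`).
[cite: Rivlin1974, Sect. 1.5 Ex. 1.5.39] -/
theorem abs_chebyshevBasis_eval_le_sqrt_two (hk : k < n) {x : ℝ} (hx : x ∈ Set.Icc (-1 : ℝ) 1) :
    |(Lagrange.basis (Finset.range n) (chebyshevZero n) k).eval x| ≤ Real.sqrt 2 := by
  have hn : 0 < n := Nat.zero_lt_of_lt hk
  have h := sum_chebyshevBasis_eval_sq_le_two hn hx
  have hk' : ((Lagrange.basis (Finset.range n) (chebyshevZero n) k).eval x) ^ 2 ≤ 2 :=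
    (single_le_sum
      (fun j _ => sq_nonneg ((Lagrange.basis (Finset.range n) (chebyshevZero n) j).eval x))
      (mem_range.mpr hk)).trans h
  rw [← Real.sqrt_sq_eq_abs]
  exact Real.sqrt_le_sqrt hk'

/-- Ex. 1.5.39, power form: `Σ_k |l_{k,n}(T;x)|^m ≤ (√2)^m` for integers `m ≥ 2`, `x ∈ I`
(`|l_k|^m ≤ (√2)^{m-2} l_k²` and the case `m = 2`). [cite: Rivlin1974, Sect. 1.5 Ex. 1.5.39] -/
theorem sum_abs_chebyshevBasis_eval_pow_le (hn : 0 < n) {m : ℕ} (hm : 2 ≤ m) {x : ℝ}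
    (hx : x ∈ Set.Icc (-1 : ℝ) 1) :
    ∑ k ∈ range n, |(Lagrange.basis (Finset.range n) (chebyshevZero n) k).eval x| ^ m
      ≤ Real.sqrt 2 ^ m := by
  obtain ⟨r, rfl⟩ := Nat.exists_eq_add_of_le hm
  have h2 : Real.sqrt 2 ^ (2 + r) = Real.sqrt 2 ^ r * 2 := by
    rw [pow_add, Real.sq_sqrt (by norm_num : (0 : ℝ) ≤ 2)]; ring
  rw [h2]
  calc ∑ k ∈ range n, |(Lagrange.basis (Finset.range n) (chebyshevZero n) k).eval x| ^ (2 + r)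
      ≤ ∑ k ∈ range n, Real.sqrt 2 ^ r
          * ((Lagrange.basis (Finset.range n) (chebyshevZero n) k).eval x) ^ 2 := by
        refine sum_le_sum fun k hk => ?_
        rw [pow_add, sq_abs, mul_comm]
        exact mul_le_mul_of_nonneg_right
          (pow_le_pow_left₀ (abs_nonneg _)
            (abs_chebyshevBasis_eval_le_sqrt_two (mem_range.mp hk) hx) r)
          (sq_nonneg _)
    _ ≤ Real.sqrt 2 ^ r * 2 := by
        rw [← mul_sum]
        exact mul_le_mul_of_nonneg_left (sum_chebyshevBasis_eval_sq_le_two hn hx)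
          (pow_nonneg (Real.sqrt_nonneg _) _)

/-- Ex. 1.5.39 verbatim: `(Σ_k |l_{k,n}(T;x)|^m)^{1/m} ≤ √2` for each integer `m ≥ 2` and
`x ∈ I`. [cite: Rivlin1974, Sect. 1.5 Ex. 1.5.39] -/
theorem rpow_inv_sum_abs_chebyshevBasis_eval_pow_le (hn : 0 < n) {m : ℕ} (hm : 2 ≤ m) {x : ℝ}
    (hx : x ∈ Set.Icc (-1 : ℝ) 1) :
    (∑ k ∈ range n, |(Lagrange.basis (Finset.range n) (chebyshevZero n) k).eval x| ^ m)
        ^ ((m : ℝ)⁻¹) ≤ Real.sqrt 2 := by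
  have hm0 : m ≠ 0 := by omega
  have hs : 0 ≤ ∑ k ∈ range n, |(Lagrange.basis (Finset.range n) (chebyshevZero n) k).eval x| ^ m :=
    sum_nonneg fun k _ => pow_nonneg (abs_nonneg _) _
  calc (∑ k ∈ range n, |(Lagrange.basis (Finset.range n) (chebyshevZero n) k).eval x| ^ m)
        ^ ((m : ℝ)⁻¹)
      ≤ (Real.sqrt 2 ^ m) ^ ((m : ℝ)⁻¹) :=
        Real.rpow_le_rpow hs (sum_abs_chebyshevBasis_eval_pow_le hn hm hx) (by positivity)
    _ = Real.sqrt 2 := Real.pow_rpow_inv_natCast (Real.sqrt_nonneg _) hm0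

/-! ### The endpoint value `Σ_k l_k(±1)² = 2 - 1/n` (Ex. 1.5.37 at `θ = 0, π`; Ex. 1.5.38) -/

/-- Division-free: `l_{k,n}(T;1)² (1 - ξ_k) n² = 1 + ξ_k` (from
`l_k(1)(1 - ξ_k)T_n'(ξ_k) = T_n(1) = 1` and Ex. 1.2.3 `T_n'(ξ_k)²(1 - ξ_k²) = n²`).
[cite: Rivlin1974, Sect. 1.5 Ex. 1.5.37 (θ = 0)] -/
theorem chebyshevBasis_eval_one_sq_mul (hk : k < n) :
    ((Lagrange.basis (Finset.range n) (chebyshevZero n) k).eval 1) ^ 2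
        * (1 - chebyshevZero n k) * (n : ℝ) ^ 2 = 1 + chebyshevZero n k := by
  have h := basis_mul_eval hk 1
  rw [Chebyshev.T_eval_one] at h
  have hd := derivative_T_eval_sq_mul hk
  have h2 : ((Lagrange.basis (Finset.range n) (chebyshevZero n) k).eval 1) ^ 2
      * (1 - chebyshevZero n k) ^ 2
      * ((derivative (Chebyshev.T ℝ n)).eval (chebyshevZero n k) ^ 2 * (1 - chebyshevZero n k ^ 2))
      = 1 - chebyshevZero n k ^ 2 := by
    have := congr_arg (fun y => y ^ 2 * (1 - chebyshevZero n k ^ 2)) h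
    simp only [one_pow, one_mul] at this
    linear_combination this
  rw [hd] at h2
  have hne : 1 - chebyshevZero n k ≠ 0 := by
    intro h0
    have := one_sub_chebyshevZero_sq_pos hk
    rw [show chebyshevZero n k = 1 by linarith] at this
    norm_num at this
  have : (1 : ℝ) - chebyshevZero n k ^ 2 = (1 - chebyshevZero n k) * (1 + chebyshevZero n k) := by
    ring
  rw [this] at h2
  apply mul_left_cancel₀ hne
  linear_combination h2

/-- `l_{k,n}(T;1)² = (1 + ξ_k)/((1 - ξ_k) n²)` (`= cot²(θ_k/2)/n²`).
[cite: Rivlin1974, Sect. 1.5 Ex. 1.5.37 (θ = 0)] -/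
theorem chebyshevBasis_eval_one_sq (hk : k < n) :
    ((Lagrange.basis (Finset.range n) (chebyshevZero n) k).eval 1) ^ 2
      = (1 + chebyshevZero n k) / ((1 - chebyshevZero n k) * (n : ℝ) ^ 2) := by
  have hne : 1 - chebyshevZero n k ≠ 0 := by
    intro h0
    have := one_sub_chebyshevZero_sq_pos hk
    rw [show chebyshevZero n k = 1 by linarith] at this
    norm_num at this
  have hn : (n : ℝ) ≠ 0 := by exact_mod_cast Nat.ne_zero_of_lt hk
  rw [eq_div_iff (mul_ne_zero hne (pow_ne_zero 2 hn)), ← mul_assoc,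
    chebyshevBasis_eval_one_sq_mul hk]

/-- Ex. 1.5.37 at `θ = 0` (the endpoint value behind Ex. 1.5.38): `Σ_k l_{k,n}(T;1)² = 2 - 1/n`
(via `Σ_k 1/(1 - ξ_k) = n²`). [cite: Rivlin1974, Sect. 1.5 Ex. 1.5.37, Ex. 1.5.38] -/
theorem sum_chebyshevBasis_eval_one_sq (hn : 0 < n) :
    ∑ k ∈ range n, ((Lagrange.basis (Finset.range n) (chebyshevZero n) k).eval 1) ^ 2
      = 2 - 1 / (n : ℝ) := by
  have hn' : (n : ℝ) ≠ 0 := by exact_mod_cast hn.ne'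
  have hterm : ∀ k ∈ range n,
      ((Lagrange.basis (Finset.range n) (chebyshevZero n) k).eval 1) ^ 2
        = (2 * (1 / (1 - chebyshevZero n k)) - 1) / (n : ℝ) ^ 2 := by
    intro k hk
    have hk' := mem_range.mp hk
    have hne : 1 - chebyshevZero n k ≠ 0 := by
      intro h0
      have := one_sub_chebyshevZero_sq_pos hk'
      rw [show chebyshevZero n k = 1 by linarith] at this
      norm_num at this
    rw [chebyshevBasis_eval_one_sq hk']
    field_simp
    ring
  rw [sum_congr rfl hterm, ← sum_div, sum_sub_distrib, ← mul_sum, sum_inv_one_sub_chebyshevZero,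
    sum_const, card_range]
  field_simp
  ring

/-- Division-free: `l_{k,n}(T;-1)² (1 + ξ_k) n² = 1 - ξ_k` (`T_n(-1)² = 1`).
[cite: Rivlin1974, Sect. 1.5 Ex. 1.5.37 (θ = π)] -/
theorem chebyshevBasis_eval_neg_one_sq_mul (hk : k < n) :
    ((Lagrange.basis (Finset.range n) (chebyshevZero n) k).eval (-1)) ^ 2
        * (1 + chebyshevZero n k) * (n : ℝ) ^ 2 = 1 - chebyshevZero n k := by
  have h := basis_mul_eval hk (-1)
  have hT : ((Chebyshev.T ℝ n).eval (-1)) ^ 2 = 1 := by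
    have h1 : (Chebyshev.T ℝ n).eval (-1) = (-1) ^ n := by simp
    rw [h1, ← pow_mul, mul_comm, pow_mul, neg_one_sq, one_pow]
  have hd := derivative_T_eval_sq_mul hk
  have h2 : ((Lagrange.basis (Finset.range n) (chebyshevZero n) k).eval (-1)) ^ 2
      * (1 + chebyshevZero n k) ^ 2
      * ((derivative (Chebyshev.T ℝ n)).eval (chebyshevZero n k) ^ 2 * (1 - chebyshevZero n k ^ 2))
      = 1 - chebyshevZero n k ^ 2 := by
    have := congr_arg (fun y => y ^ 2 * (1 - chebyshevZero n k ^ 2)) h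
    simp only [hT, one_mul] at this
    linear_combination this
  rw [hd] at h2
  have hne : 1 + chebyshevZero n k ≠ 0 := by
    intro h0
    have := one_sub_chebyshevZero_sq_pos hk
    rw [show chebyshevZero n k = -1 by linarith] at this
    norm_num at this
  have : (1 : ℝ) - chebyshevZero n k ^ 2 = (1 + chebyshevZero n k) * (1 - chebyshevZero n k) := by
    ring
  rw [this] at h2
  apply mul_left_cancel₀ hne
  linear_combination h2

/-- `l_{k,n}(T;-1)² = (1 - ξ_k)/((1 + ξ_k) n²)` (`= tan²(θ_k/2)/n²`).
[cite: Rivlin1974, Sect. 1.5 Ex. 1.5.37 (θ = π)] -/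
theorem chebyshevBasis_eval_neg_one_sq (hk : k < n) :
    ((Lagrange.basis (Finset.range n) (chebyshevZero n) k).eval (-1)) ^ 2
      = (1 - chebyshevZero n k) / ((1 + chebyshevZero n k) * (n : ℝ) ^ 2) := by
  have hne : 1 + chebyshevZero n k ≠ 0 := by
    intro h0
    have := one_sub_chebyshevZero_sq_pos hk
    rw [show chebyshevZero n k = -1 by linarith] at this
    norm_num at this
  have hn : (n : ℝ) ≠ 0 := by exact_mod_cast Nat.ne_zero_of_lt hk
  rw [eq_div_iff (mul_ne_zero hne (pow_ne_zero 2 hn)), ← mul_assoc,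
    chebyshevBasis_eval_neg_one_sq_mul hk]

/-- Ex. 1.5.37 at `θ = π` (the endpoint value behind Ex. 1.5.38):
`Σ_k l_{k,n}(T;-1)² = 2 - 1/n` (via `Σ_k 1/(1 + ξ_k) = n²`).
[cite: Rivlin1974, Sect. 1.5 Ex. 1.5.37, Ex. 1.5.38] -/
theorem sum_chebyshevBasis_eval_neg_one_sq (hn : 0 < n) :
    ∑ k ∈ range n, ((Lagrange.basis (Finset.range n) (chebyshevZero n) k).eval (-1)) ^ 2
      = 2 - 1 / (n : ℝ) := by
  have hn' : (n : ℝ) ≠ 0 := by exact_mod_cast hn.ne'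
  have hterm : ∀ k ∈ range n,
      ((Lagrange.basis (Finset.range n) (chebyshevZero n) k).eval (-1)) ^ 2
        = (2 * (1 / (1 + chebyshevZero n k)) - 1) / (n : ℝ) ^ 2 := by
    intro k hk
    have hk' := mem_range.mp hk
    have hne : 1 + chebyshevZero n k ≠ 0 := by
      intro h0
      have := one_sub_chebyshevZero_sq_pos hk'
      rw [show chebyshevZero n k = -1 by linarith] at this
      norm_num at this
    rw [chebyshevBasis_eval_neg_one_sq hk']
    field_simp
    ring
  rw [sum_congr rfl hterm, ← sum_div, sum_sub_distrib, ← mul_sum, sum_inv_one_add_chebyshevZero,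
    sum_const, card_range]
  field_simp
  ring

end Literature.Analysis.Approximation.ChebyshevFundamentalSquares
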